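import Mathlib
import HarnessLib
import Summits.NavierStokesRegularity.NavierStokesRegularity.Theorems.LocalSineTubeDoorGenericDoor
import Summits.NavierStokesRegularity.NavierStokesRegularity.Theorems.LocalLambTubeDoorBeltramiProfileRigidity

/-!
# The one-window door family — THE LAMB-VECTOR (Beltrami) DOOR, an UNCONDITIONAL local regularity criterion

Cell ns-regularity-ideate, seat p6 (route-directed support for nsreg-p1's door family; anchor
`--supports stmt-NavierStokesRegularity-20017`, the zoom item of the family; rung N0-LocalTubeDoorSine neighbourhood).
The generic first-order door template `…LocalSineTubeDoorGenericDoor.genericDoor_of_profileWindowRigidity` instantiated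
with the LAMB VECTOR, `F(x, A) = ‖x × curlCLM A‖` — continuous, with scaling-invariant zero set — whose profile window
crux is the THEOREM `…LocalLambTubeDoorBeltramiProfileRigidity.beltramiWindowRigidity` (Beltrami Type-I profiles are
trivial: the vorticity of a Beltrami profile is a bounded ancient caloric field).  Result (`localTubeDoorLamb`):

  for a classical Leray–Hopf solution on `[0,T)` from rapidly decaying data that is LOCALLY Type I at `(x₀, T)`, if the
  scale-normalised Lamb vector fades in `L¹` over ONE nonempty open similarity window,
  `∫_U (T−t)^{3/2} ‖(u × curl u)(t, x₀ + √(T−t) y)‖ dy → 0` as `t → T⁻`,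
  then `u` stays bounded near `x₀` up to `T` (`IsBackwardBoundedAt u T x₀`).

(`(T−t)^{3/2} (u × ω)` is the scale-invariant normalisation: `u ∼ (T−t)^{-1/2}`, `ω ∼ (T−t)^{-1}`.)  Local
BELTRAMISATION — alignment of velocity and vorticity, the classical «depletion of nonlinearity» — on one similarity
window thus rules out a locally Type-I singularity; the sine / cross doors constrain the DIRECTION FIELD of `ω`, the
velocity / vorticity-window doors its SIZE, this door the ANGLE between `u` and `ω`.

* `continuous_lambNorm`, `lambNorm_zeroSet_invariant`, `cross_smul_smul` — the template's side conditions for `F`;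
* `localTubeDoorLamb` — the door.

WHAT THIS IS NOT: not a claim about Navier–Stokes regularity (Clay A) — a LOCAL regularity CRITERION conditional on
local Type I (bears_on LADDER-NS N0); establishment in the cell's sense needs the cross-family referee PASS +
independent reproduction.
-/

noncomputable section

-- the summit and its single sub-problem share the name (CONVENTIONS §1), as in every Theorems file
set_option linter.dupNamespace false

namespace Summit.NavierStokesRegularity.NavierStokesRegularity.Theorems.LocalLambTubeDoorTarget

open MeasureTheory Set Function Filter Topology TopologicalSpace Metric
open scoped RealInnerProductSpace InnerProductSpace NNReal ENNReal
open Literature.Analysis Literature.Analysis.FluidPDE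
open Summit.NavierStokesRegularity.NavierStokesRegularity.Theorems.LocalSineTubeDoorGenericDoor
open Summit.NavierStokesRegularity.NavierStokesRegularity.Theorems.LocalLambTubeDoorBeltramiProfileRigidity

/-- Bilinearity of the cross product under scalings: `(a x) × (b y) = (a b) (x × y)`. -/
theorem cross_smul_smul (a b : ℝ) (x y : EuclideanSpace ℝ (Fin 3)) :
    cross (a • x) (b • y) = (a * b) • cross x y := by
  rw [← crossCLM_apply, ← crossCLM_apply, map_smul, map_smul, _root_.smul_apply,
    smul_smul, mul_comm]

/-- The Lamb-vector scalar `F(x, A) = ‖x × curlCLM A‖` is continuous in `(x, A)`. -/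
theorem continuous_lambNorm :
    Continuous fun q : EuclideanSpace ℝ (Fin 3) × (EuclideanSpace ℝ (Fin 3) →L[ℝ] EuclideanSpace ℝ (Fin 3)) =>
      ‖cross q.1 (curlCLM q.2)‖ := by
  have h : Continuous fun q : EuclideanSpace ℝ (Fin 3) × (EuclideanSpace ℝ (Fin 3) →L[ℝ] EuclideanSpace ℝ (Fin 3)) =>
      crossCLM q.1 (curlCLM q.2) :=
    crossCLM.continuous₂.comp (continuous_fst.prodMk (curlCLM.continuous.comp continuous_snd))
  have h' := continuous_norm.comp h
  simpa only [Function.comp_def, crossCLM_apply] using h'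

/-- The zero set of `F(x, A) = ‖x × curlCLM A‖` is invariant under positive rescalings of both arguments. -/
theorem lambNorm_zeroSet_invariant :
    ∀ (a b : ℝ), 0 < a → 0 < b → ∀ (x : EuclideanSpace ℝ (Fin 3))
      (A : EuclideanSpace ℝ (Fin 3) →L[ℝ] EuclideanSpace ℝ (Fin 3)),
      ‖cross (a • x) (curlCLM (b • A))‖ = 0 ↔ ‖cross x (curlCLM A)‖ = 0 := by
  intro a b ha hb x A
  rw [map_smul, cross_smul_smul, norm_smul, mul_eq_zero, Real.norm_eq_abs, abs_eq_zero, mul_eq_zero,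
    or_iff_right (not_or.2 ⟨ha.ne', hb.ne'⟩)]

/-- **THE LAMB-VECTOR (BELTRAMI) DOOR — unconditional.**  A classical Leray–Hopf solution on `[0,T)` from rapidly
decaying data, LOCALLY Type I at `(x₀,T)`, whose scale-normalised Lamb vector `(T−t)^{3/2} (u × curl u)` fades in `L¹`
over one nonempty open similarity window `x₀ + √(T−t) U` as `t → T⁻`, is backward bounded at `x₀`. -/
theorem localTubeDoorLamb :
    ∀ (ν T : ℝ), 0 < ν → 0 < T → ∀ (u : ℝ → EuclideanSpace ℝ (Fin 3) → EuclideanSpace ℝ (Fin 3))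
      (p : ℝ → EuclideanSpace ℝ (Fin 3) → ℝ),
    Literature.Analysis.FluidPDE.IsClassicalNSSolutionOn (Set.Ico 0 T) ν 0 u p →
    Literature.Analysis.FluidPDE.IsLerayHopfOn T ν 0 (u 0) u →
    Literature.Analysis.FluidPDE.HasRapidSpatialDecay (u 0) →
    ∀ (x₀ : EuclideanSpace ℝ (Fin 3)) (ρ M : ℝ), 0 < ρ →
    (∀ t ∈ Set.Ico 0 T, T - ρ ^ 2 < t → ∀ x ∈ Metric.ball x₀ ρ, ‖u t x‖ * Real.sqrt (ν * (T - t)) ≤ M) →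
    ∀ (U : Set (EuclideanSpace ℝ (Fin 3))), IsOpen U → U.Nonempty →
    Filter.Tendsto (fun t => ∫⁻ y in U, ENNReal.ofReal
      (Real.sqrt (T - t) ^ 3 * ‖Literature.Analysis.FluidPDE.cross (u t (x₀ + Real.sqrt (T - t) • y))
        (Literature.Analysis.FluidPDE.curl (u t) (x₀ + Real.sqrt (T - t) • y))‖))
      (nhdsWithin T (Set.Iio T)) (nhds 0) →
    Literature.Analysis.FluidPDE.IsBackwardBoundedAt u T x₀ := by
  intro ν T hν hT u p hsol hLH hdec x₀ ρ M hρ hM U hU hUne hfade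
  refine genericDoor_of_profileWindowRigidity (fun x A => ‖cross x (curlCLM A)‖) continuous_lambNorm
    lambNorm_zeroSet_invariant beltramiWindowRigidity ν T hν hT u p hsol hLH hdec x₀ ρ M hρ hM U hU hUne ?_
  refine hfade.congr fun t => ?_
  refine lintegral_congr fun y => ?_
  have hs : 0 ≤ Real.sqrt (T - t) := Real.sqrt_nonneg _
  rw [map_smul, ← curl_eq_curlCLM, cross_smul_smul, norm_smul, Real.norm_eq_abs, abs_of_nonneg (by positivity),
    abs_of_nonneg (by positivity)]
  ring_nf

end Summit.NavierStokesRegularity.NavierStokesRegularity.Theorems.LocalLambTubeDoorTarget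

end
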